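import Mathlib.Topology.Compactness.SigmaCompact
import Mathlib.Topology.Compactness.LocallyCompact
import Mathlib.Topology.Separation.Hausdorff
import Mathlib.Data.Finset.Card
import Mathlib.Tactic.IntervalCases
import HarnessLib

/-!
# Bredon's bootstrap lemma for properties of open sets

G. E. Bredon, *Topology and Geometry* (1993), Lemma V.9.? ("Let `M` be an `n`-manifold with a
countable basis … suppose `P(U)` is a statement about open subsets of `M` satisfying (1) `P` holds
for open sets diffeomorphic to convex sets, (2) `P(U), P(V), P(U ∩ V) ⇒ P(U ∪ V)`, (3) `P` is
preserved by disjoint unions; then `P(M)` holds", the device behind de Rham's theorem, Thm. V.9.5,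
and Poincaré duality), in the abstract topological form in which it is used twice (first inside one
chart, then across charts):

`open_bootstrap`: let `Good` be a property of subsets of a Hausdorff space `X` that holds for `∅`,
satisfies Mayer–Vietoris for open sets and is preserved by countable disjoint unions of open sets;
let `𝒞` be a family of good open sets closed under pairwise intersections; let `W` admit an
exhaustion by compact sets `K₀ ⊆ K₁° ⊆ K₁ ⊆ ⋯` and assume every point of an open `O ⊆ W` has a
`𝒞`-neighbourhood inside `O`. Then `Good W`.

Proof (Bredon, loc. cit.): finite unions of members of `𝒞` are good (induction on the number of
sets, the intersection with a new set being again such a union); cover the compact "annuli"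
`Kᵢ ∖ Kᵢ₋₁°` by finitely many members of `𝒞` inside the open "shells" `Kᵢ₊₁° ∖ Kᵢ₋₂`, group the
resulting finite unions `Wᵢ` (which meet only for `|i - j| ≤ 2`) six at a time into two
sequences of pairwise disjoint finite unions with union `W` and whose intersection is again a
disjoint union of finite unions of members of `𝒞`, and apply Mayer–Vietoris once more.
`exists_compact_exhaustion_of_isOpen` supplies the exhaustion for open subsets of a
second-countable locally compact Hausdorff space.

## References

* G. E. Bredon, *Topology and Geometry*, GTM 139 (1993), §V.9 (the bootstrap lemma preceding
  Thm. V.9.5), also §VI.8 (Poincaré duality).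
-/

open Set Filter
open scoped _root_.Topology

namespace Literature.Topology

variable {X : Type*} [TopologicalSpace X]

/-! ### Finite unions of a family closed under intersection -/

section FiniteUnions

variable (Good : Set X → Prop) (𝒞 : Set (Set X))

/-- **Finite unions of members of an intersection-closed family of good open sets are good**, when
`Good` satisfies Mayer–Vietoris and holds for `∅` (Bredon (1993), §V.9, first step of the
bootstrap: "`(U₁ ∪ ⋯ ∪ U_k) ∩ U_{k+1}` is a union of `k` convex sets"). [cite: Bredon1993, §V.9] -/
theorem good_biUnion_finset (h0 : Good ∅)
    (hMV : ∀ U V, IsOpen U → IsOpen V → Good U → Good V → Good (U ∩ V) → Good (U ∪ V))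
    (hopen : ∀ S ∈ 𝒞, IsOpen S) (hgood : ∀ S ∈ 𝒞, Good S) (hint : ∀ S ∈ 𝒞, ∀ S' ∈ 𝒞, S ∩ S' ∈ 𝒞) :
    ∀ (F : Finset (Set X)), (↑F ⊆ 𝒞) → Good (⋃ S ∈ F, S) := by
  classical
  -- strong induction on the number of sets
  suffices h : ∀ (n : ℕ) (F : Finset (Set X)), F.card ≤ n → (↑F ⊆ 𝒞) → Good (⋃ S ∈ F, S) from
    fun F hF ↦ h _ F le_rfl hF
  intro n
  induction n with
  | zero =>
    intro F hF _
    rw [Finset.card_eq_zero.1 (Nat.le_zero.1 hF)]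
    simpa using h0
  | succ n ih =>
    intro F hF h𝒞
    rcases F.eq_empty_or_nonempty with rfl | ⟨S, hS⟩
    · simpa using h0
    have hF' : (F.erase S).card ≤ n := by
      rw [Finset.card_erase_of_mem hS]; omega
    have h𝒞' : (↑(F.erase S) : Set (Set X)) ⊆ 𝒞 := fun T hT ↦ h𝒞 (Finset.mem_of_mem_erase hT)
    have hSC : S ∈ 𝒞 := h𝒞 hS
    -- `⋃ F = (⋃ F.erase S) ∪ S`
    have hsplit : (⋃ T ∈ F, T) = (⋃ T ∈ F.erase S, T) ∪ S := by
      conv_lhs => rw [← Finset.insert_erase hS]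
      rw [Finset.set_biUnion_insert, union_comm]
    rw [hsplit]
    refine hMV _ _ (isOpen_biUnion fun T hT ↦ hopen T (h𝒞' hT)) (hopen S hSC) (ih _ hF' h𝒞')
      (hgood S hSC) ?_
    -- the intersection is the union of the `T ∩ S`
    have hinter : (⋃ T ∈ F.erase S, T) ∩ S = ⋃ T ∈ (F.erase S).image (· ∩ S), T := by
      rw [Finset.set_biUnion_finset_image, iUnion₂_inter]
    rw [hinter]
    refine ih _ (Finset.card_image_le.trans hF') fun T hT ↦ ?_
    obtain ⟨T', hT', rfl⟩ := Finset.mem_image.1 hT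
    exact hint T' (h𝒞' hT') S hSC

end FiniteUnions

/-! ### Shells of an exhaustion -/

section Shells

variable (K : ℕ → Set X)

/-- The exhaustion shifted by two empty sets: `Ke 0 = Ke 1 = ∅`, `Ke (i + 2) = K i`. [folklore] -/
def shiftExh : ℕ → Set X
  | 0 => ∅
  | 1 => ∅
  | i + 2 => K i

omit [TopologicalSpace X] in
/-- The shifted exhaustion starts with `∅`. [folklore] -/
@[simp] theorem shiftExh_zero : shiftExh K 0 = ∅ := rfl

omit [TopologicalSpace X] in
/-- The shifted exhaustion has `∅` in second place. [folklore] -/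
@[simp] theorem shiftExh_one : shiftExh K 1 = ∅ := rfl

omit [TopologicalSpace X] in
/-- The shifted exhaustion is the exhaustion from the third place on. [folklore] -/
@[simp] theorem shiftExh_add_two (i : ℕ) : shiftExh K (i + 2) = K i := rfl

variable {K}

/-- The shifted exhaustion is monotone in consecutive steps. [folklore] -/
theorem shiftExh_subset_interior_succ (hKint : ∀ i, K i ⊆ interior (K (i + 1))) (i : ℕ) :
    shiftExh K i ⊆ interior (shiftExh K (i + 1)) := by
  match i with
  | 0 => exact empty_subset _
  | 1 => exact empty_subset _
  | i + 2 => exact hKint i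

/-- The shifted exhaustion is monotone. [folklore] -/
theorem shiftExh_mono (hKint : ∀ i, K i ⊆ interior (K (i + 1))) {i j : ℕ} (h : i ≤ j) :
    shiftExh K i ⊆ shiftExh K j := by
  induction h with
  | refl => exact Subset.rfl
  | step _ ih => exact ih.trans ((shiftExh_subset_interior_succ hKint _).trans interior_subset)

/-- The shifted exhaustion consists of compact sets. [folklore] -/
theorem isCompact_shiftExh (hKc : ∀ i, IsCompact (K i)) (i : ℕ) : IsCompact (shiftExh K i) := by
  match i with
  | 0 => exact isCompact_empty
  | 1 => exact isCompact_empty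
  | i + 2 => exact hKc i

variable (K) in
/-- The `i`-th **shell** `Kᵢ₊₁° ∖ Kᵢ₋₂` of the exhaustion (indices shifted): an open set. [folklore] -/
def shell (i : ℕ) : Set X := interior (shiftExh K (i + 3)) \ shiftExh K i

variable (K) in
/-- The `i`-th **annulus** `Kᵢ ∖ Kᵢ₋₁°` of the exhaustion (indices shifted): a compact set. [folklore] -/
def annulus (i : ℕ) : Set X := shiftExh K (i + 2) \ interior (shiftExh K (i + 1))

/-- Shells are open (in a Hausdorff space, where compact sets are closed). [folklore] -/
theorem isOpen_shell [T2Space X] (hKc : ∀ i, IsCompact (K i)) (i : ℕ) : IsOpen (shell K i) :=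
  isOpen_interior.sdiff (isCompact_shiftExh hKc i).isClosed

/-- Annuli are compact. [folklore] -/
theorem isCompact_annulus (hKc : ∀ i, IsCompact (K i)) (i : ℕ) : IsCompact (annulus K i) :=
  (isCompact_shiftExh hKc (i + 2)).diff isOpen_interior

/-- Each annulus lies in the corresponding shell. [folklore] -/
theorem annulus_subset_shell (hKint : ∀ i, K i ⊆ interior (K (i + 1))) (i : ℕ) :
    annulus K i ⊆ shell K i := fun _ hx ↦
  ⟨shiftExh_subset_interior_succ hKint _ hx.1, fun h ↦ hx.2 (shiftExh_subset_interior_succ hKint _ h)⟩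

variable (K) in
/-- Shells are contained in the union of the exhaustion. [folklore] -/
theorem shell_subset_iUnion (i : ℕ) : shell K i ⊆ ⋃ j, K j := fun _ hx ↦
  mem_iUnion.2 ⟨i + 1, interior_subset hx.1⟩

/-- **Far-apart shells are disjoint**: `shell a` and `shell b` can only meet if `b ≤ a + 2` (and
symmetrically). [folklore] -/
theorem shell_inter_shell_eq_empty (hKint : ∀ i, K i ⊆ interior (K (i + 1))) {a b : ℕ} (h : a + 3 ≤ b) :
    shell K a ∩ shell K b = ∅ := by
  refine eq_empty_of_forall_notMem fun x ⟨hxa, hxb⟩ ↦ hxb.2 ?_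
  exact shiftExh_mono hKint h (interior_subset hxa.1)

/-- If two shells meet then their indices differ by at most `2`. [folklore] -/
theorem le_add_two_of_shell_inter_nonempty (hKint : ∀ i, K i ⊆ interior (K (i + 1))) {a b : ℕ}
    (h : (shell K a ∩ shell K b).Nonempty) : b ≤ a + 2 ∧ a ≤ b + 2 := by
  constructor
  · by_contra hc
    rw [shell_inter_shell_eq_empty hKint (by omega)] at h
    exact h.ne_empty rfl
  · by_contra hc
    rw [inter_comm, shell_inter_shell_eq_empty hKint (by omega)] at h
    exact h.ne_empty rfl

variable (K) in
/-- The annuli cover the union of the exhaustion. [folklore] -/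
theorem iUnion_annulus_eq : (⋃ i, annulus K i) = ⋃ i, K i := by
  classical
  refine Subset.antisymm (iUnion_subset fun i x hx ↦ ?_) fun x hx ↦ ?_
  · exact mem_iUnion.2 ⟨i, hx.1⟩
  · -- the least `i` with `x ∈ Ke (i + 2)`
    have hex : ∃ i, x ∈ shiftExh K (i + 2) := by
      obtain ⟨i, hi⟩ := mem_iUnion.1 hx; exact ⟨i, hi⟩
    refine mem_iUnion.2 ⟨Nat.find hex, Nat.find_spec hex, fun h ↦ ?_⟩
    have hx' : x ∈ shiftExh K (Nat.find hex + 1) := interior_subset h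
    match hm : Nat.find hex with
    | 0 => rw [hm] at hx'; exact hx'
    | m + 1 =>
      rw [hm] at hx'
      exact Nat.find_min hex (m := m) (by omega) hx'

end Shells

/-! ### The bootstrap -/

section Bootstrap

variable [T2Space X] (Good : Set X → Prop) (𝒞 : Set (Set X))

/-- **Bredon's bootstrap lemma** (abstract form). Let `Good` hold for `∅`, satisfy Mayer–Vietoris
for open sets and pass to countable pairwise disjoint unions of open sets; let `𝒞` be a family of
good open sets closed under pairwise intersection; let `W = ⋃ Kᵢ` with `Kᵢ` compact,
`Kᵢ ⊆ Kᵢ₊₁°`, such that every point of an open `O ⊆ W` has a `𝒞`-neighbourhood inside `O`. Then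
`Good W` (Bredon (1993), §V.9, the lemma before Thm. V.9.5). [cite: Bredon1993, §V.9] -/
theorem open_bootstrap (h0 : Good ∅)
    (hMV : ∀ U V, IsOpen U → IsOpen V → Good U → Good V → Good (U ∩ V) → Good (U ∪ V))
    (hdisj : ∀ U : ℕ → Set X, (∀ i, IsOpen (U i)) → Pairwise (Function.onFun Disjoint U) →
      (∀ i, Good (U i)) → Good (⋃ i, U i))
    (hopen : ∀ S ∈ 𝒞, IsOpen S) (hgood : ∀ S ∈ 𝒞, Good S) (hint : ∀ S ∈ 𝒞, ∀ S' ∈ 𝒞, S ∩ S' ∈ 𝒞)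
    {K : ℕ → Set X} (hKc : ∀ i, IsCompact (K i)) (hKint : ∀ i, K i ⊆ interior (K (i + 1)))
    (hcover : ∀ O, IsOpen O → O ⊆ ⋃ i, K i → ∀ x ∈ O, ∃ S ∈ 𝒞, x ∈ S ∧ S ⊆ O) :
    Good (⋃ i, K i) := by
  classical
  have hfin := good_biUnion_finset Good 𝒞 h0 hMV hopen hgood hint
  -- (1) finite covers of the annuli inside the shells
  have hstep : ∀ i, ∃ F : Finset (Set X), (↑F ⊆ 𝒞) ∧ annulus K i ⊆ (⋃ S ∈ F, S) ∧ (⋃ S ∈ F, S) ⊆ shell K i := by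
    intro i
    have hsh := hcover (shell K i) (isOpen_shell hKc i) (shell_subset_iUnion K i)
    choose! f hfC hfx hfsub using hsh
    obtain ⟨t, ht, hcov⟩ := (isCompact_annulus hKc i).elim_nhds_subcover f fun x hx ↦
      (hopen _ (hfC x (annulus_subset_shell hKint i hx))).mem_nhds (hfx x (annulus_subset_shell hKint i hx))
    refine ⟨t.image f, ?_, ?_, ?_⟩
    · intro S hS
      obtain ⟨x, hx, rfl⟩ := Finset.mem_image.1 hS
      exact hfC x (annulus_subset_shell hKint i (ht x hx))
    · rw [Finset.set_biUnion_finset_image]; exact hcov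
    · rw [Finset.set_biUnion_finset_image]
      exact iUnion₂_subset fun x hx ↦ hfsub x (annulus_subset_shell hKint i (ht x hx))
  choose F hFC hFcov hFsub using hstep
  -- finite unions of members of `𝒞`, as a function of a finset
  set V : Finset (Set X) → Set X := fun G ↦ ⋃ S ∈ G, S with hV
  have hVopen : ∀ G : Finset (Set X), (↑G ⊆ 𝒞) → IsOpen (V G) := fun G hG ↦
    isOpen_biUnion fun S hS ↦ hopen S (hG hS)
  have hVunion : ∀ G G' : Finset (Set X), V (G ∪ G') = V G ∪ V G' := fun G G' ↦
    Finset.set_biUnion_union _ _ _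
  -- (2) group six consecutive covers: `A`-blocks and `B`-blocks
  set GX : ℕ → Finset (Set X) := fun i ↦ F (6 * i) ∪ F (6 * i + 1) ∪ F (6 * i + 2) with hGX
  set GY : ℕ → Finset (Set X) := fun i ↦ F (6 * i + 3) ∪ F (6 * i + 4) ∪ F (6 * i + 5) with hGY
  have hGXC : ∀ i, (↑(GX i) : Set (Set X)) ⊆ 𝒞 := fun i S hS ↦ by
    simp only [hGX, Finset.coe_union, mem_union, Finset.mem_coe] at hS
    rcases hS with (hS | hS) | hS <;> exact hFC _ hS
  have hGYC : ∀ i, (↑(GY i) : Set (Set X)) ⊆ 𝒞 := fun i S hS ↦ by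
    simp only [hGY, Finset.coe_union, mem_union, Finset.mem_coe] at hS
    rcases hS with (hS | hS) | hS <;> exact hFC _ hS
  -- supports: the blocks live in three consecutive shells
  have hVX : ∀ i, V (GX i) ⊆ shell K (6 * i) ∪ shell K (6 * i + 1) ∪ shell K (6 * i + 2) := fun i ↦ by
    simp only [hGX, hVunion]
    exact union_subset_union (union_subset_union (hFsub _) (hFsub _)) (hFsub _)
  have hVY : ∀ i, V (GY i) ⊆ shell K (6 * i + 3) ∪ shell K (6 * i + 4) ∪ shell K (6 * i + 5) := fun i ↦ by
    simp only [hGY, hVunion]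
    exact union_subset_union (union_subset_union (hFsub _) (hFsub _)) (hFsub _)
  -- if a point lies in shells `a` and `b` then `|a - b| ≤ 2`
  have hmeet : ∀ {a b : ℕ} {x : X}, x ∈ shell K a → x ∈ shell K b → b ≤ a + 2 ∧ a ≤ b + 2 :=
    fun hxa hxb ↦ le_add_two_of_shell_inter_nonempty hKint ⟨_, hxa, hxb⟩
  have hXdisj : Pairwise (Function.onFun Disjoint fun i ↦ V (GX i)) := by
    intro i j hij
    refine disjoint_left.2 fun x hxi hxj ↦ hij ?_
    rcases hVX i hxi with (ha | ha) | ha <;> rcases hVX j hxj with (hb | hb) | hb <;>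
      · have h := hmeet ha hb; omega
  have hYdisj : Pairwise (Function.onFun Disjoint fun i ↦ V (GY i)) := by
    intro i j hij
    refine disjoint_left.2 fun x hxi hxj ↦ hij ?_
    rcases hVY i hxi with (ha | ha) | ha <;> rcases hVY j hxj with (hb | hb) | hb <;>
      · have h := hmeet ha hb; omega
  have hXY : ∀ {i j : ℕ} {x : X}, x ∈ V (GX i) → x ∈ V (GY j) → j = i ∨ j + 1 = i := by
    intro i j x hxi hxj
    rcases hVX i hxi with (ha | ha) | ha <;> rcases hVY j hxj with (hb | hb) | hb <;>
      · have h := hmeet ha hb; omega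
  -- (3) the two disjoint unions `A`, `B` and their intersection
  set A : Set X := ⋃ i, V (GX i) with hA
  set B : Set X := ⋃ i, V (GY i) with hB
  have hgoodA : Good A := hdisj _ (fun i ↦ hVopen _ (hGXC i)) hXdisj fun i ↦ hfin _ (hGXC i)
  have hgoodB : Good B := hdisj _ (fun i ↦ hVopen _ (hGYC i)) hYdisj fun i ↦ hfin _ (hGYC i)
  -- the pieces of `A ∩ B`
  set GZ : ℕ → Finset (Set X) := fun i ↦
    ((GX i) ×ˢ (GY i ∪ GY (i - 1))).image fun p ↦ p.1 ∩ p.2 with hGZ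
  have hGZC : ∀ i, (↑(GZ i) : Set (Set X)) ⊆ 𝒞 := fun i S hS ↦ by
    obtain ⟨p, hp, rfl⟩ := Finset.mem_image.1 hS
    rw [Finset.mem_product] at hp
    refine hint _ (hGXC i hp.1) _ ?_
    rcases Finset.mem_union.1 hp.2 with h | h
    · exact hGYC i h
    · exact hGYC (i - 1) h
  have hVZ : ∀ i, V (GZ i) = V (GX i) ∩ (V (GY i) ∪ V (GY (i - 1))) := fun i ↦ by
    ext x
    simp only [hV, hGZ, mem_iUnion, Finset.mem_image, Finset.mem_product, Finset.mem_union, exists_prop,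
      mem_inter_iff, mem_union]
    constructor
    · rintro ⟨_, ⟨⟨S, T⟩, ⟨hS, hT⟩, rfl⟩, hx⟩
      exact ⟨⟨S, hS, hx.1⟩, hT.imp (fun h ↦ ⟨T, h, hx.2⟩) fun h ↦ ⟨T, h, hx.2⟩⟩
    · rintro ⟨⟨S, hS, hxS⟩, ⟨T, hT, hxT⟩ | ⟨T, hT, hxT⟩⟩
      · exact ⟨_, ⟨⟨S, T⟩, ⟨hS, Or.inl hT⟩, rfl⟩, hxS, hxT⟩
      · exact ⟨_, ⟨⟨S, T⟩, ⟨hS, Or.inr hT⟩, rfl⟩, hxS, hxT⟩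
  have hZdisj : Pairwise (Function.onFun Disjoint fun i ↦ V (GZ i)) := fun i j hij ↦
    (hXdisj hij).mono (show V (GZ i) ≤ V (GX i) by rw [hVZ]; exact inter_subset_left)
      (show V (GZ j) ≤ V (GX j) by rw [hVZ]; exact inter_subset_left)
  have hAB : A ∩ B = ⋃ i, V (GZ i) := by
    refine Subset.antisymm ?_ (iUnion_subset fun i x hx ↦ ?_)
    · rintro x ⟨hxA, hxB⟩
      obtain ⟨i, hxi⟩ := mem_iUnion.1 hxA
      obtain ⟨j, hxj⟩ := mem_iUnion.1 hxB
      refine mem_iUnion.2 ⟨i, ?_⟩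
      rw [hVZ]
      rcases hXY hxi hxj with rfl | hji
      · exact ⟨hxi, Or.inl hxj⟩
      · refine ⟨hxi, Or.inr ?_⟩
        rwa [show i - 1 = j by omega]
    · rw [hVZ] at hx
      exact ⟨mem_iUnion.2 ⟨i, hx.1⟩, hx.2.elim (fun h ↦ mem_iUnion.2 ⟨i, h⟩) fun h ↦ mem_iUnion.2 ⟨i - 1, h⟩⟩
  have hgoodAB : Good (A ∩ B) := by
    rw [hAB]
    exact hdisj _ (fun i ↦ hVopen _ (hGZC i)) hZdisj fun i ↦ hfin _ (hGZC i)
  -- (4) `A ∪ B = ⋃ Kᵢ`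
  have hAuB : A ∪ B = ⋃ i, K i := by
    refine Subset.antisymm ?_ ?_
    · refine union_subset (iUnion_subset fun i ↦ (hVX i).trans ?_) (iUnion_subset fun i ↦ (hVY i).trans ?_) <;>
        exact union_subset (union_subset (shell_subset_iUnion K _) (shell_subset_iUnion K _))
          (shell_subset_iUnion K _)
    · rw [← iUnion_annulus_eq K]
      refine iUnion_subset fun n x hx ↦ ?_
      have hxF : x ∈ V (F n) := hFcov n hx
      -- `n = 6 i + r`
      obtain ⟨i, r, hr, rfl⟩ : ∃ i r, r < 6 ∧ n = 6 * i + r := ⟨n / 6, n % 6, Nat.mod_lt _ (by omega), by omega⟩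
      have hxV : ∀ {G G' : Finset (Set X)}, x ∈ V G → G ⊆ G' → x ∈ V G' := fun hx h ↦ by
        simp only [hV, mem_iUnion, exists_prop] at hx ⊢
        obtain ⟨S, hS, hxS⟩ := hx
        exact ⟨S, h hS, hxS⟩
      interval_cases r
      · exact Or.inl (mem_iUnion.2 ⟨i, hxV hxF (Finset.subset_union_left.trans Finset.subset_union_left)⟩)
      · exact Or.inl (mem_iUnion.2 ⟨i, hxV hxF (Finset.subset_union_right.trans Finset.subset_union_left)⟩)
      · exact Or.inl (mem_iUnion.2 ⟨i, hxV hxF Finset.subset_union_right⟩)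
      · exact Or.inr (mem_iUnion.2 ⟨i, hxV hxF (Finset.subset_union_left.trans Finset.subset_union_left)⟩)
      · exact Or.inr (mem_iUnion.2 ⟨i, hxV hxF (Finset.subset_union_right.trans Finset.subset_union_left)⟩)
      · exact Or.inr (mem_iUnion.2 ⟨i, hxV hxF Finset.subset_union_right⟩)
  rw [← hAuB]
  exact hMV A B (isOpen_iUnion fun i ↦ hVopen _ (hGXC i)) (isOpen_iUnion fun i ↦ hVopen _ (hGYC i))
    hgoodA hgoodB hgoodAB

omit [T2Space X] in
/-- **Compact exhaustions of open subsets** of a second-countable, locally compact Hausdorff space: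
`W = ⋃ Kᵢ` with `Kᵢ` compact and `Kᵢ ⊆ Kᵢ₊₁°` (Mathlib's `CompactExhaustion` of the open
subspace, pushed forward). [folklore] -/
theorem exists_compact_exhaustion_of_isOpen [SecondCountableTopology X] [LocallyCompactSpace X]
    {W : Set X} (hW : IsOpen W) :
    ∃ K : ℕ → Set X, (∀ i, IsCompact (K i)) ∧ (∀ i, K i ⊆ interior (K (i + 1))) ∧ ⋃ i, K i = W := by
  haveI : LocallyCompactSpace W := hW.locallyCompactSpace
  let Ke := CompactExhaustion.choice W
  refine ⟨fun i ↦ ((↑) : W → X) '' Ke i, fun i ↦ (Ke.isCompact i).image continuous_subtype_val,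
    fun i ↦ ?_, ?_⟩
  · exact (image_mono (Ke.subset_interior_succ i)).trans (hW.isOpenMap_subtype_val.image_interior_subset _)
  · rw [← image_iUnion, Ke.iUnion_eq, image_univ, Subtype.range_coe]

end Bootstrap

end Literature.Topology
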